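/-
Copyright (c) 2026 the pub-hodgecm-mathlib formalisation cell (harness21).  Prover seat hodgecm-mathlib-K2E1-p03 (g2), Track B ∕ K2-LIT (stream 29),
h413 = `stmt-HodgeConjecture-24833`, line `K2_E1_TraceFormulaBeta`, helper `K2E1HermitianSignaturePlaceParity` (dealer K2E1-plan (g0): BY-NAME DEAL (2)
2026-09-03T22:15:53Z, re-cut 22:25:50Z as the SIGNATURE half over ★ p855197 `K2E1HermitianDiscriminantPlaceParity` of K2E4-p18 (g2)).  2026-09-03.
-/
import Summits.HodgeConjecture.HodgeConjecture.Theorems.K2E1HermitianDiscriminantPlaceParity   -- ★ p855197 (K2E4-p18 (g2)): disc ∈ L⁺, Hilbert reciprocity for `(disc, θ)`, archimedean reading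
import Literature.LinearAlgebra.Matrix.PosDefHermitianPairDiagonalization                      -- ★ `IsHermitian.exists_eq_conj_diagonal` (Mathlib's spectral frame, packaged); imports Mathlib
import HarnessLib

/-!
# h413 ∕ Track B «K2-LIT», line `K2_E1_TraceFormulaBeta`: THE SIGNATURE READING OF THE HERMITIAN DISCRIMINANT PLACE PARITY —
# «`Σ_{v real} q_v ≡ #{finite v : (disc Φ, −δ)_v = −1} (mod 2)`» (helper `K2E1HermitianSignaturePlaceParity`; dealer K2E1-plan (g0) DEAL (2) 2026-09-03T22:15:53Z
# clause (iii), re-cut 22:25:50Z to sit ON TOP of ★ `K2E1HermitianDiscriminantPlaceParity` (K2E4-p18 (g2), p855197); rows 19∕20 inner-form bookkeeping [Rogawski1990, §14.1–14.2])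

Cell `pub/hodgecm-mathlib`, crux H413 = `stmt-HodgeConjecture-24833`, route `HCCMUnconditional`; chair K2-lead (g0), dealer K2E1-plan (g0).  THEOREMS ONLY (no `def`,
no `instance`, no `notation`, no named-fact hypothesis, no `sorry`); lane `--supports stmt-HodgeConjecture-24833 --as helper` (count-neutral).

WHAT ★ `K2E1HermitianDiscriminantPlaceParity` ALREADY PROVES (cited by name, not restated): `disc Φ = det Φ ∈ L⁺` for `(Φ.map c)ᵀ = Φ` (`complexConj_det`,
`det_mem_maximalRealSubfield`, `exists_coe_eq_det`); for `a, θ ∈ Kˣ` with `θ` totally negative, `{v finite | (a,θ)_v = −1}` is finite and `#{v finite | (a,θ)_v = −1} +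
#{w real | σ_w(a) < 0}` is EVEN (`finite_and_even_ncard_add_ncard_neg_of_neg`, Hilbert reciprocity ★ `hilbertReciprocity_holds`), `{w | (a,θ)_w = −1} = {w | σ_w(a) < 0}`
(`setOf_infinitePlace_symbol_eq_neg_one_eq_of_neg`); the canonical generator `θ = cmQuadraticGenerator L` and generator∕basis independence.

WHAT THIS FILE ADDS — the SIGNATURES.  At an infinite place `W` of the CM field `L` (`W ↦ W|_{L⁺}` is Mathlib's bijection `IsCMField.equivInfinitePlace` onto the
real places of `L⁺`) the complex matrix `H^W := H.map W.embedding` of a `c`-hermitian `H ∈ Mₙ(L)` is HERMITIAN (`isHermitian_map`: EVERY `φ : L →+* ℂ` intertwines `c`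
with complex conjugation, Mathlib `IsCMField.complexEmbedding_complexConj`), and its negative index of inertia `q_W := #{i | e_i < 0}` — read from ANY frame `Tᴴ H^W T = diag(e)`,
`det T ≠ 0`, `e` real (frame-independent by Sylvester, ★ `Literature.LinearAlgebra.Matrix.card_neg_eq_of_conjTranspose_mul_diagonal_mul`; e.g. Mathlib's spectral frame,
`q_W = #{i | λ_i(H^W) < 0}`) — satisfies **`sign σ_w(disc H) = (−1)^{q_W}`** (`w = W|_{L⁺}`): `det H^W · |det T|² = ∏ e_i` (§1) and `σ_w(det H) = det H^W` (§3).  Hence: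
* `hilbertSymbol_eq_neg_one_iff_det_re_neg` ∕ **`hilbertSymbol_eq_neg_one_iff_odd`** — `(d, b)_w = −1 ⟺ det H^W < 0 ⟺ q_W` odd (`d = det H`, `L = L⁺(θ)`, `θ² = b`);
* `ncard_setOf_embedding_lt_zero_eq` — `#{w real | σ_w(d) < 0} = #{W | q_W odd}`;
* **`HermitianSignaturePlaceParity`** — `Even (#{v finite | (d, b)_v = −1} + Σ_W q_W)` for ANY assignment `q` of negative indices read from frames, i.e.
  «`Σ_{v real} q_v ≡ #{finite v : (disc Φ, −δ)_v = −1} (mod 2)»` — the parity constraint on the local invariants (Landherr) of a global hermitian form that rows 19∕20 cite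
  when choosing inner forms `U_Φ` with prescribed signatures; `…_eigenvalues` (frame-free, Mathlib's `IsHermitian.eigenvalues`) and `…_cmQuadraticGenerator` (★'s `θ`).
CURRENCY: `θ : L`, `c θ = −θ ≠ 0`, `θ² = b ∈ L⁺` (any generator; `b` is totally negative — PROVED here, `embedding_lt_zero_of_sq`; for ★'s canonical `cmQuadraticGenerator`
use ★ `cmQuadraticGenerator_spec`); `H : Matrix (Fin n) (Fin n) L`, `det H ≠ 0`, `d : L⁺` with `algebraMap L⁺ L d = det H` (hermitian-ness of `H` is only needed for the
eigenvalue form — a real diagonal frame at every `W` already forces it); symbols `hilbertSymbol (L⁺_v) d b` as in ★ (`Literature.NumberTheory.QuadraticForms.hilbertSymbol`).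
(ii) of the deal (odd `n` ⇒ `U(Φ)_v` quasi-split at every finite `v`) stays a REMARK: it needs the local classification [Jacobowitz1962, Thm. 3.1], not in the tree.

HONEST LABEL.  HC_CM is proved only modulo the 7 printed citations (2 remaining named inputs: hLiu418 = `stmt-HodgeConjecture-24832`, h413 = `stmt-HodgeConjecture-24833`)
until rung 0 closes; this file proves no printed statement of [Rogawski1990] and is count-neutral.

## References
* [Rogawski1990] J. Rogawski, *Automorphic representations of unitary groups in three variables*, Ann. of Math. Stud. 123 (1990), §14.1–§14.2 (global unitary groups
  `U_Φ`, local invariants, choice of inner forms) — context of use.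
* [Landherr1936HermitianForms] W. Landherr, *Äquivalenz Hermitescher Formen über einem beliebigen algebraischen Zahlkörper*, Abh. Math. Sem. Hamburg 11 (1936) 245–248
  (invariants `n`, `disc mod N(Lˣ)`, signatures `(p_w, q_w)`; the parity relation).
* [Omeara1963] O. T. O'Meara, *Introduction to Quadratic Forms* (1963), §63B (Hilbert symbol), §71 Thm. 71:18 (Hilbert reciprocity).
* [Scharlau1985HermitianForms] W. Scharlau, *Quadratic and Hermitian Forms*, Grundlehren 270 (1985), Ch. 10 §1 (1.1)–(1.6).
* [Jacobowitz1962] R. Jacobowitz, *Hermitian forms over local fields*, Amer. J. Math. 84 (1962) 441–465, Thm. 3.1.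
* [HornJohnson2013] R. A. Horn, C. R. Johnson, *Matrix Analysis*, 2nd ed. (2013), Thm. 4.5.8 (Sylvester's law of inertia), Thm. 4.1.5 (spectral theorem).
-/

set_option autoImplicit false
set_option linter.dupNamespace false  -- the mandated namespace repeats the summit's segment (`HodgeConjecture.HodgeConjecture`)

noncomputable section

namespace Summit.HodgeConjecture.HodgeConjecture.Cruxes.H413.K2E1HermitianSignaturePlaceParity

open NumberField IsDedekindDomain Matrix Finset Complex
open Literature.NumberTheory.QuadraticForms (hilbertSymbol)
open Literature.NumberTheory.Automorphic (cmQuadraticGenerator cmQuadraticGenerator_spec)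
open Summit.HodgeConjecture.HodgeConjecture.Cruxes.H413.K2E1HermitianDiscriminantPlaceParity (setOf_infinitePlace_symbol_eq_neg_one_eq_of_neg
  finite_and_even_ncard_add_ncard_neg_of_neg)
open scoped ComplexConjugate

/-! ## §1 Over `ℂ`: the sign of `det A` for `A` congruent to a real diagonal matrix is `(−1)^{#negative entries}` -/

section LinearAlgebra

variable {ι : Type*} [Fintype ι] [DecidableEq ι]

omit [DecidableEq ι] in
/-- **Sign of a product of non-zero reals**: `∏ e_i < 0 ⟺ #{i | e_i < 0}` is odd (`∏ e_i = (−1)^{#neg} · ∏ |e_i|`). [folklore] -/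
theorem prod_neg_iff_odd_card_neg (e : ι → ℝ) (he : ∀ i, e i ≠ 0) :
    ∏ i, e i < 0 ↔ Odd (Fintype.card {i // e i < 0}) := by
  have hsplit : ∏ i, e i = (∏ i, (if e i < 0 then (-1 : ℝ) else 1)) * ∏ i, |e i| := by
    rw [← Finset.prod_mul_distrib]
    refine Finset.prod_congr rfl fun i _ => ?_
    split_ifs with h
    · rw [abs_of_neg h]; ring
    · rw [abs_of_nonneg (not_lt.mp h)]; ring
  have hsign : ∏ i, (if e i < 0 then (-1 : ℝ) else 1) = (-1) ^ Fintype.card {i // e i < 0} := by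
    rw [Finset.prod_ite, Finset.prod_const_one, mul_one, Finset.prod_const, Fintype.card_subtype]
  have hpos : 0 < ∏ i, |e i| := Finset.prod_pos fun i _ => abs_pos.mpr (he i)
  rw [hsplit, hsign, mul_neg_iff, or_iff_right (fun h => (not_lt.mpr hpos.le) h.2), and_iff_left hpos]
  rcases Nat.even_or_odd (Fintype.card {i // e i < 0}) with h | h
  · rw [h.neg_one_pow]; exact ⟨fun h1 => absurd h1 (by norm_num), fun h2 => absurd h2 (Nat.not_odd_iff_even.mpr h)⟩
  · rw [h.neg_one_pow]; exact ⟨fun _ => h, fun _ => by norm_num⟩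

/-- **`det A · |det T|² = ∏ e_i`** when `Tᴴ A T = diag(e)` with `e` real (`det Tᴴ = conj (det T)`). [cite: HornJohnson2013, Thm. 4.5.8] -/
theorem det_mul_normSq_eq_prod (A T : Matrix ι ι ℂ) (e : ι → ℝ) (hT : Tᴴ * A * T = Matrix.diagonal (fun i => (e i : ℂ))) :
    A.det * (Complex.normSq T.det : ℂ) = ((∏ i, e i : ℝ) : ℂ) := by
  have h := congrArg Matrix.det hT
  rw [det_mul, det_mul, det_conjTranspose, det_diagonal, ← Complex.ofReal_prod] at h
  rw [← h, ← Complex.mul_conj, Complex.star_def]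
  ring

/-- … hence `det A` is real and `(det A).re · |det T|² = ∏ e_i`. [folklore] -/
theorem det_re_mul_normSq_eq_prod (A T : Matrix ι ι ℂ) (e : ι → ℝ) (hT : Tᴴ * A * T = Matrix.diagonal (fun i => (e i : ℂ))) :
    A.det.re * Complex.normSq T.det = ∏ i, e i := by
  have h := congrArg Complex.re (det_mul_normSq_eq_prod A T e hT)
  rwa [Complex.mul_re, Complex.ofReal_re, Complex.ofReal_im, mul_zero, sub_zero, Complex.ofReal_re] at h

/-- **SIGN OF THE DETERMINANT = `(−1)^{negative index}`**: for `Tᴴ A T = diag(e)`, `det T ≠ 0`, `e_i ≠ 0` real, `det A < 0 ⟺ #{i | e_i < 0}` is odd.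
[cite: HornJohnson2013, Thm. 4.5.8] -/
theorem det_re_neg_iff_odd (A T : Matrix ι ι ℂ) (hTd : T.det ≠ 0) (e : ι → ℝ) (he : ∀ i, e i ≠ 0)
    (hT : Tᴴ * A * T = Matrix.diagonal (fun i => (e i : ℂ))) :
    A.det.re < 0 ↔ Odd (Fintype.card {i // e i < 0}) := by
  have hns : 0 < Complex.normSq T.det := Complex.normSq_pos.mpr hTd
  rw [← prod_neg_iff_odd_card_neg e he, ← det_re_mul_normSq_eq_prod A T e hT]
  constructor
  · intro h; exact mul_neg_of_neg_of_pos h hns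
  · intro h; by_contra h'; exact absurd h (not_lt.mpr (mul_nonneg (not_lt.mp h') hns.le))

/-- If `det T ≠ 0` and `det A ≠ 0` then every entry of a real diagonal frame `Tᴴ A T = diag(e)` is non-zero (`det A · |det T|² = ∏ e_i`). [folklore] -/
theorem frame_ne_zero (A T : Matrix ι ι ℂ) (hTd : T.det ≠ 0) (hA : A.det ≠ 0) (e : ι → ℝ)
    (hT : Tᴴ * A * T = Matrix.diagonal (fun i => (e i : ℂ))) (i : ι) : e i ≠ 0 := by
  intro hi
  have h := det_mul_normSq_eq_prod A T e hT
  rw [Finset.prod_eq_zero (Finset.mem_univ i) hi, Complex.ofReal_zero, mul_eq_zero] at h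
  rcases h with h | h
  · exact hA h
  · exact (Complex.normSq_pos.mpr hTd).ne' (by exact_mod_cast h)

end LinearAlgebra

/-! ## §2 CM fields: `H^φ` is hermitian for every complex embedding `φ`; `φ(θ)` is purely imaginary, so `b = θ²` is totally negative -/

section CM

variable (L : Type) [Field L] [NumberField L] [IsCMField L]

/-- For a CM field, EVERY complex embedding intertwines `complexConj L` with complex conjugation (Mathlib `IsCMField.complexEmbedding_complexConj`), so the image
`H^φ = H.map φ` of a `c`-hermitian matrix (`(H.map c)ᵀ = H`) is a HERMITIAN complex matrix. [cite: Scharlau1985HermitianForms, Ch. 10 §1 (1.1)] -/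
theorem isHermitian_map {m : Type*} (H : Matrix m m L) (hH : (H.map (IsCMField.complexConj L))ᵀ = H) (φ : L →+* ℂ) : (H.map φ).IsHermitian := by
  show (H.map φ)ᴴ = H.map φ
  ext i j
  have hij : H i j = IsCMField.complexConj L (H j i) := by
    conv_lhs => rw [← hH]
    rfl
  rw [conjTranspose_apply, map_apply, map_apply, hij, IsCMField.complexEmbedding_complexConj, Complex.star_def]

omit [NumberField L] [IsCMField L] in
/-- `φ (det H) = det H^φ`. [folklore] -/
theorem map_det_eq_det_map {m : Type*} [Fintype m] [DecidableEq m] (H : Matrix m m L) (φ : L →+* ℂ) : φ H.det = (H.map φ).det := by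
  rw [RingHom.map_det, RingHom.mapMatrix_apply]

/-- `φ θ` is PURELY IMAGINARY for `c θ = −θ`: `(φ θ).re = 0`. [folklore] -/
theorem re_map_eq_zero_of_complexConj_eq_neg (φ : L →+* ℂ) {θ : L} (hθ : IsCMField.complexConj L θ = -θ) : (φ θ).re = 0 := by
  have h := IsCMField.complexEmbedding_complexConj L φ θ
  rw [hθ, map_neg] at h
  have h2 := congrArg Complex.re h
  rw [Complex.neg_re, Complex.conj_re] at h2
  linarith

/-- **`b = θ²` is negative under every complex embedding** (`θ ≠ 0` purely imaginary): `(φ (algebraMap b)).re < 0` — `L = L⁺(√b)` with `b = −δ` TOTALLY NEGATIVE.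
[cite: Scharlau1985HermitianForms, Ch. 10 §1] -/
theorem re_map_lt_zero_of_sq (φ : L →+* ℂ) {θ : L} (hθ : IsCMField.complexConj L θ = -θ) (hθ0 : θ ≠ 0) {b : maximalRealSubfield L}
    (hb : θ * θ = algebraMap (maximalRealSubfield L) L b) : (φ (algebraMap (maximalRealSubfield L) L b)).re < 0 := by
  rw [← hb, map_mul, Complex.mul_re, re_map_eq_zero_of_complexConj_eq_neg L φ hθ, zero_mul, zero_sub, neg_lt_zero]
  have him : (φ θ).im ≠ 0 := by
    intro him
    apply hθ0
    have : φ θ = 0 := Complex.ext (re_map_eq_zero_of_complexConj_eq_neg L φ hθ) him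
    exact (map_eq_zero φ).mp this
  exact mul_self_pos.mpr him

omit [NumberField L] [IsCMField L] in
/-- `b ≠ 0` for `θ² = b`, `θ ≠ 0`. [folklore] -/
theorem ne_zero_of_sq {θ : L} (hθ0 : θ ≠ 0) {b : maximalRealSubfield L} (hb : θ * θ = algebraMap (maximalRealSubfield L) L b) : b ≠ 0 := by
  rintro rfl
  rw [map_zero, mul_self_eq_zero] at hb
  exact hθ0 hb

/-! ## §3 Real places of `L⁺` = infinite places of `L`: `σ_w = W.embedding|_{L⁺}` -/

omit [IsCMField L] in
/-- **`σ_w = W.embedding` on `L⁺`**: for an infinite place `W` of `L` above the (real) place `w` of `L⁺ = maximalRealSubfield L`, the real embedding of `w` is the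
restriction of the complex embedding of `W`: `σ_w(x) = W.embedding (x)` (`L⁺` is totally real, Mathlib `embedding_mk_eq_of_isReal`). [folklore] -/
theorem embedding_of_isReal_eq (W : InfinitePlace L) {w : InfinitePlace (maximalRealSubfield L)} (hWw : W.comap (algebraMap (maximalRealSubfield L) L) = w)
    (hw : w.IsReal) (x : maximalRealSubfield L) :
    (w.embedding_of_isReal hw x : ℂ) = W.embedding (algebraMap (maximalRealSubfield L) L x) := by
  subst hWw
  rw [InfinitePlace.embedding_of_isReal_apply]
  have h1 : W.comap (algebraMap (maximalRealSubfield L) L) = InfinitePlace.mk (W.embedding.comp (algebraMap (maximalRealSubfield L) L)) := by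
    rw [← InfinitePlace.comap_mk, InfinitePlace.mk_embedding]
  rw [h1, InfinitePlace.embedding_mk_eq_of_isReal (IsTotallyReal.complexEmbedding_isReal _)]
  rfl

/-- **`b` is negative at every real place of `L⁺`** (`θ² = b`, `c θ = −θ ≠ 0`). [cite: Scharlau1985HermitianForms, Ch. 10 §1] -/
theorem embedding_lt_zero_of_sq {θ : L} (hθ : IsCMField.complexConj L θ = -θ) (hθ0 : θ ≠ 0) {b : maximalRealSubfield L}
    (hb : θ * θ = algebraMap (maximalRealSubfield L) L b) (w : InfinitePlace (maximalRealSubfield L)) (hw : w.IsReal) :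
    w.embedding_of_isReal hw b < 0 := by
  set W := (IsCMField.equivInfinitePlace L).symm w with hW
  have hWw : W.comap (algebraMap (maximalRealSubfield L) L) = w := by
    rw [← IsCMField.equivInfinitePlace_apply, hW, Equiv.apply_symm_apply]
  rw [← Complex.ofReal_re (w.embedding_of_isReal hw b), embedding_of_isReal_eq L W hWw hw]
  exact re_map_lt_zero_of_sq L W.embedding hθ hθ0 hb

end CM

/-! ## §4 The signature reading and the parity «`Σ_W q_W ≡ #{v finite | (d, b)_v = −1} (mod 2)`» -/

section Deal

variable (L : Type) [Field L] [NumberField L] [IsCMField L]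
variable {θ : L} (hθ : IsCMField.complexConj L θ = -θ) (hθ0 : θ ≠ 0) {b : maximalRealSubfield L} (hb : θ * θ = algebraMap (maximalRealSubfield L) L b)
variable {n : ℕ} {H : Matrix (Fin n) (Fin n) L} (hH : (H.map (IsCMField.complexConj L))ᵀ = H) (hdet : H.det ≠ 0)
variable {d : maximalRealSubfield L} (hd : algebraMap (maximalRealSubfield L) L d = H.det)

include hd in
omit [IsCMField L] in
/-- **`σ_w(d) = det H^W`** for `W ∣ w`: the real embedding of the discriminant is the (real) determinant of the complex matrix `H^W = H.map W.embedding`.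
[cite: Scharlau1985HermitianForms, Ch. 10 §1 (1.3)] -/
theorem embedding_disc_eq_det_re (W : InfinitePlace L) {w : InfinitePlace (maximalRealSubfield L)}
    (hWw : W.comap (algebraMap (maximalRealSubfield L) L) = w) (hw : w.IsReal) :
    w.embedding_of_isReal hw d = ((H.map W.embedding).det).re := by
  rw [← Complex.ofReal_re (w.embedding_of_isReal hw d), embedding_of_isReal_eq L W hWw hw, hd, map_det_eq_det_map]

include hd in
omit [IsCMField L] in
/-- `σ_w(d) < 0 ⟺ det H^W < 0` (`W ∣ w`), in the `∃ hw : w.IsReal` spelling of ★ `setOf_infinitePlace_symbol_eq_neg_one_eq_of_neg`. [folklore] -/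
theorem exists_embedding_lt_zero_iff_det_re_neg (W : InfinitePlace L) {w : InfinitePlace (maximalRealSubfield L)}
    (hWw : W.comap (algebraMap (maximalRealSubfield L) L) = w) :
    (∃ hw : w.IsReal, w.embedding_of_isReal hw d < 0) ↔ ((H.map W.embedding).det).re < 0 := by
  constructor
  · rintro ⟨hw, h⟩
    rwa [embedding_disc_eq_det_re L hd W hWw hw] at h
  · intro h
    exact ⟨IsTotallyReal.isReal w, by rwa [embedding_disc_eq_det_re L hd W hWw]⟩

include hθ hθ0 hb hdet hd in
/-- **(iii, one place) `(d, b)_w = −1 ⟺ det H^W < 0`** for `W ∣ w` (★ archimedean reading `setOf_infinitePlace_symbol_eq_neg_one_eq_of_neg`, `b` totally negative by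
`embedding_lt_zero_of_sq`, and `σ_w(d) = det H^W`). [cite: Landherr1936HermitianForms] [cite: Omeara1963, §63B] -/
theorem hilbertSymbol_eq_neg_one_iff_det_re_neg (W : InfinitePlace L) {w : InfinitePlace (maximalRealSubfield L)}
    (hWw : W.comap (algebraMap (maximalRealSubfield L) L) = w) :
    hilbertSymbol w.Completion (algebraMap _ w.Completion d) (algebraMap _ w.Completion b) = -1 ↔ ((H.map W.embedding).det).re < 0 := by
  have hd0 : d ≠ 0 := by rintro rfl; rw [map_zero] at hd; exact hdet hd.symm
  have h := Set.ext_iff.mp (setOf_infinitePlace_symbol_eq_neg_one_eq_of_neg hd0 (ne_zero_of_sq L hθ0 hb) (embedding_lt_zero_of_sq L hθ hθ0 hb)) w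
  simp only [Set.mem_setOf_eq] at h
  rw [h, exists_embedding_lt_zero_iff_det_re_neg L hd W hWw]

include hθ hθ0 hb hdet hd in
/-- **(iii, one place, with a frame) `(d, b)_w = −1 ⟺ q_W` is odd**, `q_W = #{i | e_i < 0}` for ANY frame `Tᴴ H^W T = diag(e)` (`det T ≠ 0`, `e` real) of `H^W`, `W ∣ w`:
the signature `(p_W, q_W)` of `Φ ⊗_{L,W} ℂ` has `sign σ_w(disc Φ) = (−1)^{q_W}`. [cite: Landherr1936HermitianForms] [cite: HornJohnson2013, Thm. 4.5.8] -/
theorem hilbertSymbol_eq_neg_one_iff_odd (W : InfinitePlace L) {w : InfinitePlace (maximalRealSubfield L)}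
    (hWw : W.comap (algebraMap (maximalRealSubfield L) L) = w) (T : Matrix (Fin n) (Fin n) ℂ) (hTd : T.det ≠ 0) (e : Fin n → ℝ)
    (hT : Tᴴ * H.map W.embedding * T = Matrix.diagonal (fun i => (e i : ℂ))) :
    hilbertSymbol w.Completion (algebraMap _ w.Completion d) (algebraMap _ w.Completion b) = -1 ↔ Odd (Fintype.card {i // e i < 0}) := by
  have hA : (H.map W.embedding).det ≠ 0 := by
    rw [← map_det_eq_det_map, map_ne_zero]
    exact hdet
  rw [hilbertSymbol_eq_neg_one_iff_det_re_neg L hθ hθ0 hb hdet hd W hWw]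
  exact det_re_neg_iff_odd _ T hTd e (frame_ne_zero _ T hTd hA e hT) hT

/-- **Parity of a sum versus the number of odd summands**: `Σ_i q_i + #{i | q_i odd}` is even. [folklore] -/
theorem even_sum_add_card_odd {κ : Type*} (s : Finset κ) (q : κ → ℕ) :
    Even (∑ i ∈ s, q i + (s.filter fun i => Odd (q i)).card) := by
  classical
  induction s using Finset.induction_on with
  | empty => simp
  | insert a s ha ih =>
    rw [Finset.sum_insert ha, Finset.filter_insert]
    by_cases hq : Odd (q a)
    · rw [if_pos hq, Finset.card_insert_of_notMem (fun h => ha (Finset.mem_filter.mp h).1),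
        show q a + ∑ i ∈ s, q i + ((s.filter fun i => Odd (q i)).card + 1) = (∑ i ∈ s, q i + (s.filter fun i => Odd (q i)).card) + (q a + 1) by ring]
      exact ih.add hq.add_one
    · rw [if_neg hq, show q a + ∑ i ∈ s, q i + (s.filter fun i => Odd (q i)).card = (∑ i ∈ s, q i + (s.filter fun i => Odd (q i)).card) + q a by ring]
      exact ih.add (Nat.not_odd_iff_even.mp hq)

include hdet hd in
/-- **(iii, the count) `#{w real | σ_w(d) < 0} = #{W : InfinitePlace L | q_W odd}`** for any assignment `q` of negative indices read from frames `Tᴴ H^W T = diag(e)`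
(through Mathlib's bijection `IsCMField.equivInfinitePlace : InfinitePlace L ≃ InfinitePlace L⁺`). [cite: Landherr1936HermitianForms] -/
theorem ncard_setOf_embedding_lt_zero_eq (q : InfinitePlace L → ℕ)
    (hq : ∀ W : InfinitePlace L, ∃ (T : Matrix (Fin n) (Fin n) ℂ) (e : Fin n → ℝ), T.det ≠ 0 ∧
      Tᴴ * H.map W.embedding * T = Matrix.diagonal (fun i => (e i : ℂ)) ∧ Fintype.card {i // e i < 0} = q W) :
    {w : InfinitePlace (maximalRealSubfield L) | ∃ hw : w.IsReal, w.embedding_of_isReal hw d < 0}.ncard = {W : InfinitePlace L | Odd (q W)}.ncard := by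
  classical
  have hA : ∀ W : InfinitePlace L, (H.map W.embedding).det ≠ 0 := fun W => by
    rw [← map_det_eq_det_map, map_ne_zero]; exact hdet
  -- at `W`: `σ_{W|L⁺}(d) < 0 ⟺ q_W odd`
  have key : ∀ W : InfinitePlace L,
      (∃ hw : (W.comap (algebraMap (maximalRealSubfield L) L)).IsReal, (W.comap (algebraMap (maximalRealSubfield L) L)).embedding_of_isReal hw d < 0) ↔
        Odd (q W) := fun W => by
    obtain ⟨T, e, hTd, hT, hqe⟩ := hq W
    rw [exists_embedding_lt_zero_iff_det_re_neg L hd W rfl, ← hqe]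
    exact det_re_neg_iff_odd _ T hTd e (frame_ne_zero _ T hTd (hA W) e hT) hT
  set E := IsCMField.equivInfinitePlace L with hE
  have hset : {w : InfinitePlace (maximalRealSubfield L) | ∃ hw : w.IsReal, w.embedding_of_isReal hw d < 0} = E '' {W : InfinitePlace L | Odd (q W)} := by
    ext w
    simp only [Set.mem_setOf_eq, Set.mem_image]
    constructor
    · intro hw
      refine ⟨E.symm w, ?_, E.apply_symm_apply w⟩
      have hWw : (E.symm w).comap (algebraMap (maximalRealSubfield L) L) = w := by
        rw [← IsCMField.equivInfinitePlace_apply, Equiv.apply_symm_apply]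
      exact (key (E.symm w)).mp (by rw [hWw]; exact hw)
    · rintro ⟨W, hW, rfl⟩
      exact (key W).mpr hW
  rw [hset, Set.ncard_image_of_injective _ E.injective]

include hθ hθ0 hb hdet hd in
/-- **THE DEAL (iii) — `HermitianSignaturePlaceParity`.**  Let `L` be a CM field, `L = L⁺(θ)` with `θ² = b ∈ L⁺` (so `b = −δ` is totally negative), `H ∈ Mₙ(L)` with `det H ≠ 0` and
discriminant `d ∈ L⁺` (`algebraMap d = det H`), and let `q_W` (`W` an infinite place of `L` = a real place of `L⁺`) be the negative index of inertia of the hermitian matrix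
`H^W`, read from any frame `Tᴴ H^W T = diag(e)`.  Then **`#{v finite place of L⁺ | (d, b)_v = −1} + Σ_W q_W` is EVEN**: «`Σ_{v real} q_v ≡ #{finite v : (disc Φ, −δ)_v = −1}
(mod 2)`» — ★ Hilbert reciprocity with a totally negative partner (`finite_and_even_ncard_add_ncard_neg_of_neg`), the real places read through `sign σ_w(d) = (−1)^{q_w}`.
[cite: Landherr1936HermitianForms] [cite: Omeara1963, §71 Thm. 71:18] [cite: Rogawski1990, §14.1] -/
theorem HermitianSignaturePlaceParity (q : InfinitePlace L → ℕ)
    (hq : ∀ W : InfinitePlace L, ∃ (T : Matrix (Fin n) (Fin n) ℂ) (e : Fin n → ℝ), T.det ≠ 0 ∧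
      Tᴴ * H.map W.embedding * T = Matrix.diagonal (fun i => (e i : ℂ)) ∧ Fintype.card {i // e i < 0} = q W) :
    Even ({v : HeightOneSpectrum (𝓞 (maximalRealSubfield L)) |
        hilbertSymbol (v.adicCompletion (maximalRealSubfield L)) (algebraMap _ _ d) (algebraMap _ _ b) = -1}.ncard +
      ∑ W : InfinitePlace L, q W) := by
  classical
  have hd0 : d ≠ 0 := by rintro rfl; rw [map_zero] at hd; exact hdet hd.symm
  have h1 := (finite_and_even_ncard_add_ncard_neg_of_neg hd0 (ne_zero_of_sq L hθ0 hb) (embedding_lt_zero_of_sq L hθ hθ0 hb)).2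
  rw [ncard_setOf_embedding_lt_zero_eq L hdet hd q hq] at h1
  have h2 := even_sum_add_card_odd (Finset.univ : Finset (InfinitePlace L)) q
  have h3 : {W : InfinitePlace L | Odd (q W)}.ncard = (Finset.univ.filter fun W => Odd (q W)).card := by
    rw [Set.ncard_eq_toFinset_card', Set.toFinset_setOf]
  rw [h3] at h1
  -- (N + C) + (S + C) = (N + S) + 2C is even ⇒ N + S is even
  set N := {v : HeightOneSpectrum (𝓞 (maximalRealSubfield L)) |
        hilbertSymbol (v.adicCompletion (maximalRealSubfield L)) (algebraMap _ _ d) (algebraMap _ _ b) = -1}.ncard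
  set C := (Finset.univ.filter fun W => Odd (q W)).card
  have h4 := h1.add h2
  rw [show N + C + (∑ W, q W + C) = (N + ∑ W, q W) + 2 * C by ring] at h4
  exact (Nat.even_add.mp h4).mpr (even_two_mul _)

include hθ hθ0 hb hH hdet hd in
/-- **Frame-free form** (`q_W = #{i | λ_i(H^W) < 0}`, `λ_i` = Mathlib `IsHermitian.eigenvalues`, frame = Mathlib's unitary eigenframe via ★ `IsHermitian.exists_eq_conj_diagonal`):
`#{v finite | (d, b)_v = −1} + Σ_W #{i | λ_i(H^W) < 0}` is even. [cite: Landherr1936HermitianForms] [cite: Omeara1963, §71 Thm. 71:18] [cite: HornJohnson2013, Thm. 4.1.5] -/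
theorem HermitianSignaturePlaceParity_eigenvalues :
    Even ({v : HeightOneSpectrum (𝓞 (maximalRealSubfield L)) |
        hilbertSymbol (v.adicCompletion (maximalRealSubfield L)) (algebraMap _ _ d) (algebraMap _ _ b) = -1}.ncard +
      ∑ W : InfinitePlace L, Fintype.card {i // (isHermitian_map L H hH W.embedding).eigenvalues i < 0}) := by
  refine HermitianSignaturePlaceParity L hθ hθ0 hb hdet hd _ fun W => ?_
  obtain ⟨U, -, hUU', hU, hsp⟩ := Literature.LinearAlgebra.Matrix.IsHermitian.exists_eq_conj_diagonal (isHermitian_map L H hH W.embedding)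
  refine ⟨U, (isHermitian_map L H hH W.embedding).eigenvalues, hU.ne_zero, ?_, rfl⟩
  -- `Uᴴ (U Λ Uᴴ) U = Λ`
  have hsp' : H.map W.embedding = U * Matrix.diagonal (fun i => (((isHermitian_map L H hH W.embedding).eigenvalues i : ℝ) : ℂ)) * Uᴴ := hsp
  conv_lhs => rw [hsp']
  calc Uᴴ * (U * Matrix.diagonal (fun i => (((isHermitian_map L H hH W.embedding).eigenvalues i : ℝ) : ℂ)) * Uᴴ) * U
      = (Uᴴ * U) * Matrix.diagonal (fun i => (((isHermitian_map L H hH W.embedding).eigenvalues i : ℝ) : ℂ)) * (Uᴴ * U) := by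
        simp only [Matrix.mul_assoc]
    _ = _ := by rw [hUU', Matrix.one_mul, Matrix.mul_one]

include hH hdet hd in
/-- **★'s canonical generator**: the same parity with `θ = cmQuadraticGenerator L` (★ `K2E1HermitianDiscriminantPlaceParity.hermitianDiscriminantPlaceParity`'s partner) —
`#{v finite | (d, θ)_v = −1} + Σ_W #{i | λ_i(H^W) < 0}` is even. [cite: Landherr1936HermitianForms] [cite: Omeara1963, §71 Thm. 71:18] -/
theorem HermitianSignaturePlaceParity_cmQuadraticGenerator :
    Even ({v : HeightOneSpectrum (𝓞 (maximalRealSubfield L)) |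
        hilbertSymbol (v.adicCompletion (maximalRealSubfield L)) (algebraMap _ _ d)
          (algebraMap _ _ (cmQuadraticGenerator L : maximalRealSubfield L)) = -1}.ncard +
      ∑ W : InfinitePlace L, Fintype.card {i // (isHermitian_map L H hH W.embedding).eigenvalues i < 0}) := by
  obtain ⟨α, hα0, hα, hαsq⟩ := cmQuadraticGenerator_spec L
  exact HermitianSignaturePlaceParity_eigenvalues L hα hα0 (by rw [← sq]; exact hαsq) hH hdet hd

end Deal

end Summit.HodgeConjecture.HodgeConjecture.Cruxes.H413.K2E1HermitianSignaturePlaceParity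

end
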